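/-
Copyright (c) 2026 the pub-hodgecm-mathlib formalisation cell (harness21).  Prover seat hodgecm-mathlib-K2E3-p29 (g0), HCML Track B «K2-LIT» (build stream 29),
h413 = `stmt-HodgeConjecture-24833`, line `K2_E3_EllipticInputs`, unit U12 «Characters», PART «SC» leaf (SC-an)₂ (road «FC₂», CLOSE-OUT DAY strike line L4 `stub_StCharTS`,
LINE-LEAD K2E3-plan (g4), deal D135 sequel «(ε)₂ RE-THREAD» FILE 3 OF 3 «(ε-Model₂)»): `|D_G|^{−r}` is locally `∫⁻`-finite on the one-place model `U(σ_w, Φ₂)(L_w)` of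
`U(1,1)(L⁺_v)` for every `0 ≤ r` with `2r < 1`, in BOTH token currencies (`det⁻¹`: the exponent-parametric twin of ★ K2E3-p27's `hcd₂_model`; `det⁻²`: the (ε6)₂ letter `hHCD`
of ★ p861141 `K2E3SupercuspidalTruncatedCharWeightKitTwo` §4, which it DISCHARGES).  2026-09-04.
-/
import Summits.HodgeConjecture.HodgeConjecture.Theorems.K2E3U11WeylDiscrModel             -- ★ (HCD₂-MODEL) (K2E3-p27): `exists_lieCarrier`, `isUnit_det_placeForm_antidiagTwo`, `mem_range_subtype_two_iff`; brings ★ (MP) pins, ★ (NB), ★ `localNonsplitEquiv`, ★ `placeForm_antidiagTwo_eq`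
import Summits.HodgeConjecture.HodgeConjecture.Theorems.K2E3U11WeylDiscrLieLocIntRpow     -- ★ p861168 (this seat) (ε-Lie₂): `forall_exists_nhds_setLIntegral_eta_rpow_lt_top_lie_two`
import Summits.HodgeConjecture.HodgeConjecture.Theorems.K2E3U11WeylDiscrGroupToLieRpow    -- 📤 p861179 (this seat) (ε-Cayley₂): `exists_nhds_setLIntegral_theta_rpow_lt_top`
import Literature.NumberTheory.Rogawski1990.UnitaryTwoLocalNonsplitDictionaryCM           -- ★ `placeForm_antidiagTwo_eq_over` (`(Φ₂)_w = (StdForm.antidiagonal 2).over L_w`)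
import Literature.NumberTheory.Automorphic.AddCharConductorExponent                       -- ★ `normAbs_le_normAbs_iff_valued` (`‖·‖` vs `Valued.v` on `L_w`)
import HarnessLib

/-!
# h413 ∕ Track B «K2-LIT», (SC-an)₂ ∕ (M5h)₂ — «(ε)₂ RE-THREAD» FILE 3 «(ε-Model₂)»: `|D_G|^{−r}` IS LOCALLY `∫⁻`-FINITE ON THE ONE-PLACE MODEL `U(σ_w, Φ₂)(L_w)`
# FOR `0 ≤ r`, `2r < 1` (Harish-Chandra 1970 Part VII §1 Thm. 15 with ε-room, rank one), AND THE (ε6)₂ LETTER OF THE (M5h)₂ WEIGHT KIT DISCHARGED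

Cell `pub/hodgecm-mathlib` (D-0151), Track B «K2-LIT», crux H413 = `stmt-HodgeConjecture-24833`, route `HCCMUnconditional`.  Lane `--supports stmt-HodgeConjecture-24833
--as helper`; THEOREMS ONLY (no `def`, no `instance`, no `notation`, no named-fact hypothesis, no `sorry`); count-neutral.  Dealer K2E3-plan (g4) deal D135 (L4 EMIT #1
2026-09-04T14:52:25Z) + this seat's R0 census 14:55:02Z.

WHAT.
* §1 **`normAbs_det_eq_one`** — on ANY unitary group `U(σ_w, J)(L_w)` with `det J ≠ 0`, `‖det g‖ = 1` (`σ_w(det g)·det g = 1` from the defining equation, `‖σ_w x‖ = ‖x‖` by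
  ★ `valued_galAdicCompletionMap` + ★ `normAbs_le_normAbs_iff_valued`, `‖det g‖² = 1`).  This is the bridge between the two token currencies: the scale-invariant rank-one Weyl
  ratio `‖disc χ_g‖·‖det g‖⁻¹` of ★ K2E3-p27's HCD₂ chain and the `Fin 3 ↦ Fin 2` image `‖disc χ_g‖·‖det g‖⁻²` carried by the (M5h)₂ ports.
* §2 **`hcd₂_model_rpow`** — for `0 ≤ r`, `2r < 1`, every Borel structure, every Haar measure `ν′` on `U′ = U(σ_w, Φ₂)(L_w)` and every `g₀`:
  `∃ U ∈ 𝓝 g₀, ∫⁻_U (↑(‖disc χ_g‖_w · ‖det g‖_w⁻¹))^(−r) ∂ν′ < ∞`.  ASSEMBLY = ★ `hcd₂_model`'s, token for token, with the exponent threaded: ★ (MP) pins at `w`, ★ (NB) norm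
  bridge, the Lie carrier `𝔲` (★ `exists_lieCarrier`) with `borel` ∕ `addHaar`, ★ (ε-Lie₂) `forall_exists_nhds_setLIntegral_eta_rpow_lt_top_lie_two` on `𝔲` (needs `2r < 1`),
  local compactness ∕ second countability of `U′` along ★ `localNonsplitEquiv`, ★∕📤 (ε-Cayley₂) `exists_nhds_setLIntegral_theta_rpow_lt_top` at `G := ↥U′`, `ρ := U′.subtype`
  (needs `0 ≤ r`).  The case `r = 1∕4` is ★ `hcd₂_model` (★ (ε5) `coe_rpow_neg_quarter`).
* §3 **`hcd₂_model_rpow_of_eq_over`** — the same in the `det⁻²` currency on `U(σ_w, J)(L_w)` for `J = (StdForm.antidiagonal 2).over L_w` (★ `placeForm_antidiagTwo_eq_over`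
  identifies the carriers; §1 identifies the integrands pointwise), i.e. EXACTLY the letter `hHCD` of ★ `K2E3SupercuspidalTruncatedCharWeightKitTwo.locallyIntegrable_inv_token_*_place`
  at every admissible `r`, in particular at `r = (1 + 1∕4)∕4 = 5∕16`: **`hHCD_five_sixteenths`**.  The unconditional (M5h)₂ weight-kit heads follow in the sequel
  `K2E3SupercuspidalTruncatedCharWeightKitPlaceTwo` by `exact`.

HONEST LABEL: HC_CM is proved only modulo the 7 printed citations (2 remaining named inputs: hLiu418 = stmt-HodgeConjecture-24832, h413 = stmt-HodgeConjecture-24833) until rung 0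
closes; count-neutral helper of the (SC-an)₂ ∕ (M5h)₂ road; nothing printed is asserted as a fact; (SC-an)₂ stays OPEN.

## References
* [HarishChandra1970] Harish-Chandra (notes by G. van Dijk), *Harmonic analysis on reductive p-adic groups*, LNM 162 (1970), Part VII §1 Thm. 15 (`|D|^{−1∕2−ε} ∈ L¹_loc`), §7.
* [Rogawski1990] J. D. Rogawski, *Automorphic Representations of Unitary Groups in Three Variables* (1990), §1.9 p. 13 (`U(1,1)`), §4.9 p. 54 (`D_G`), §12.5 p. 182.
* [PlatonovRapinchuk1994] V. Platonov, A. Rapinchuk, *Algebraic Groups and Number Theory* (1994), §3.3 (`det` on unitary groups), §5.1.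
* [CasselsFrohlichANT1967] J. W. S. Cassels, A. Fröhlich (eds.), *Algebraic Number Theory* (1967), Ch. II §10, Ch. VII §1.1.
-/

set_option autoImplicit false
set_option linter.dupNamespace false

noncomputable section

open Set Filter MeasureTheory MeasureTheory.Measure TopologicalSpace Topology Matrix ValuativeRel NumberField IsDedekindDomain
open Literature.NumberTheory.Automorphic Literature.NumberTheory.Automorphic.UnitaryGroup Literature.NumberTheory.LocalFields
open Literature.NumberTheory.GaloisRepresentations Literature.NumberTheory.GaloisRepresentations.IsNonarchimedeanLocalField
open Summit.HodgeConjecture.HodgeConjecture.Cruxes.H413.F0P3cStCharTSHCDCayleyChartAt (isClosedEmbedding_subtype)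
open Summit.HodgeConjecture.HodgeConjecture.Cruxes.H413.K2E3U11WeylDiscrGroupToLieRpow (exists_nhds_setLIntegral_theta_rpow_lt_top)
open Summit.HodgeConjecture.HodgeConjecture.Cruxes.H413.K2E3U11WeylDiscrLieLocIntRpow (forall_exists_nhds_setLIntegral_eta_rpow_lt_top_lie_two)
open Summit.HodgeConjecture.HodgeConjecture.Cruxes.H413.K2E3U11WeylDiscrModel (exists_lieCarrier isUnit_det_placeForm_antidiagTwo mem_range_subtype_two_iff)
open scoped Topology ENNReal NNReal MatrixGroups Matrix

namespace Summit.HodgeConjecture.HodgeConjecture.Cruxes.H413.K2E3U11WeylDiscrModelRpow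

section CM

variable (L : Type) [Field L] [NumberField L] [IsCMField L] (v : HeightOneSpectrum (𝓞 ↥(maximalRealSubfield L)))
  (w : PlacesOver L v) (hw : IsCMField.complexConj L • w.1 = w.1)

/-! ## §1 `‖det g‖ = 1` on `U(σ_w, J)(L_w)` — the bridge between the `det⁻¹` and `det⁻²` token currencies -/

/-- **`‖det g‖_w = 1` ON ANY UNITARY GROUP `U(σ_w, J)(L_w)` WITH `det J ≠ 0`**: the defining equation `ᵗ(σ_w g)·J·g = J` gives `σ_w(det g)·det g = 1`; `σ_w` is isometric
(★ `valued_galAdicCompletionMap`, ★ `normAbs_le_normAbs_iff_valued`), so `‖det g‖² = 1` in `ℝ≥0`, whence `‖det g‖ = 1` (`NNReal.sqrt_sq`).  Any matrix size `n`.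
[cite: PlatonovRapinchuk1994, §3.3] [cite: Rogawski1990, §1.9 p. 13] -/
theorem normAbs_det_eq_one {n : ℕ} {J : Matrix (Fin n) (Fin n) (w.1.adicCompletion L)} (hJ : J.det ≠ 0)
    (g : ↥(unitaryGroupOfForm (galAdicCompletionMap (L := L) (IsCMField.complexConj L) hw) J)) :
    normAbs (w.1.adicCompletion L) (((g : GL (Fin n) (w.1.adicCompletion L)) : Matrix (Fin n) (Fin n) (w.1.adicCompletion L)).det) = 1 := by
  set d : w.1.adicCompletion L := (((g : GL (Fin n) (w.1.adicCompletion L)) : Matrix (Fin n) (Fin n) (w.1.adicCompletion L))).det with hd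
  have hg := mem_unitaryGroupOfForm_iff.1 g.2
  have h := congrArg Matrix.det hg
  rw [Matrix.det_mul, Matrix.det_mul, Matrix.det_transpose, ← RingHom.mapMatrix_apply, ← RingHom.map_det] at h
  have h1 : galAdicCompletionMap (L := L) (IsCMField.complexConj L) hw d * d = 1 := by
    have : (galAdicCompletionMap (L := L) (IsCMField.complexConj L) hw d * d) * J.det = 1 * J.det := by
      rw [one_mul, mul_right_comm]; exact h
    exact mul_right_cancel₀ hJ this
  -- `σ_w` is isometric for `‖·‖_w`
  have hσn : normAbs (w.1.adicCompletion L) (galAdicCompletionMap (L := L) (IsCMField.complexConj L) hw d) = normAbs (w.1.adicCompletion L) d :=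
    le_antisymm ((normAbs_le_normAbs_iff_valued w.1 _ _).2 (valued_galAdicCompletionMap (L := L) (IsCMField.complexConj L) hw d).le)
      ((normAbs_le_normAbs_iff_valued w.1 _ _).2 (valued_galAdicCompletionMap (L := L) (IsCMField.complexConj L) hw d).ge)
  have h2 : normAbs (w.1.adicCompletion L) d ^ 2 = 1 := by
    have h3 := congrArg (normAbs (w.1.adicCompletion L)) h1
    rwa [map_mul, hσn, map_one, ← sq] at h3
  have h4 := congrArg NNReal.sqrt h2
  rwa [NNReal.sqrt_sq, NNReal.sqrt_one] at h4

/-! ## §2 HEAD: `θᵣ` is locally `∫⁻`-finite on `U(σ_w, Φ₂)(L_w)` (`det⁻¹` currency) -/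

set_option maxHeartbeats 1600000 in
-- long binder lists instantiated at the model (same class as ★ `hcd₂_model` ∕ the ★ `3 × 3` model head)
/-- **(ε-Model₂) — `|D_G|^{−r}` IS LOCALLY `∫⁻`-FINITE ON `U(σ_w, Φ₂)(L_w)` FOR `0 ≤ r`, `2r < 1`**, for every Borel structure and Haar measure `ν′` and every point `g₀`:
`∃ U ∈ 𝓝 g₀, ∫⁻_U (↑(‖disc χ_g‖_w · ‖det g‖_w⁻¹))^(−r) ∂ν′ < ∞`.  ASSEMBLY (all ★∕📤, verbatim ★ `hcd₂_model` with the exponent threaded): `σ_w` involution + continuous; ★ (MP) pins at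
`w` (closed embedding `ι`, `Fix(σ_w) = range ι`, skew unit `lam`, norm-one scalars infinite); ★ (NB) norm bridge; `CharZero L_w`, `2 ∈ L_wˣ`; the Lie carrier `𝔲` (★
`exists_lieCarrier`) with `borel` ∕ `addHaar` (closed in `M₂(L_w)`, ★ `isClosedEmbedding_subtype`); ★ (ε-Lie₂) `forall_exists_nhds_setLIntegral_eta_rpow_lt_top_lie_two` on `𝔲`
(with `J_w = !![0,1;1,0]`, `2r < 1`); local compactness ∕ second countability of `U′` along ★ `localNonsplitEquiv` from the organ carrier; (ε-Cayley₂)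
`exists_nhds_setLIntegral_theta_rpow_lt_top` at `G := ↥U′`, `ρ := U′.subtype` (`0 ≤ r`).  The (M5h)₂ kit consumes `r = 5∕16`.
[cite: HarishChandra1970, Part VII §1 Thm. 15] [cite: Rogawski1990, §4.9 p. 54; §12.5 p. 182] [cite: PlatonovRapinchuk1994, §3.3; §5.1] -/
theorem hcd₂_model_rpow {r : ℝ} (hr0 : 0 ≤ r) (hr1 : 2 * r < 1)
    [MeasurableSpace ↥(unitaryGroupOfForm (galAdicCompletionMap (L := L) (IsCMField.complexConj L) hw)
      (placeForm (Matrix.of fun i j : Fin 2 => if i.val + j.val + 1 = 2 then (1 : L) else 0) w.1))]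
    [BorelSpace ↥(unitaryGroupOfForm (galAdicCompletionMap (L := L) (IsCMField.complexConj L) hw)
      (placeForm (Matrix.of fun i j : Fin 2 => if i.val + j.val + 1 = 2 then (1 : L) else 0) w.1))]
    (ν' : Measure ↥(unitaryGroupOfForm (galAdicCompletionMap (L := L) (IsCMField.complexConj L) hw)
      (placeForm (Matrix.of fun i j : Fin 2 => if i.val + j.val + 1 = 2 then (1 : L) else 0) w.1))) [ν'.IsHaarMeasure]
    (g₀ : ↥(unitaryGroupOfForm (galAdicCompletionMap (L := L) (IsCMField.complexConj L) hw)
      (placeForm (Matrix.of fun i j : Fin 2 => if i.val + j.val + 1 = 2 then (1 : L) else 0) w.1))) :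
    ∃ U ∈ 𝓝 g₀, ∫⁻ g in U,
      (((normAbs (w.1.adicCompletion L)
          (((g : ↥(unitaryGroupOfForm (galAdicCompletionMap (L := L) (IsCMField.complexConj L) hw)
              (placeForm (Matrix.of fun i j : Fin 2 => if i.val + j.val + 1 = 2 then (1 : L) else 0) w.1))) :
              GL (Fin 2) (w.1.adicCompletion L)) : Matrix (Fin 2) (Fin 2) (w.1.adicCompletion L)).charpoly.discr *
        (normAbs (w.1.adicCompletion L)
          (((g : ↥(unitaryGroupOfForm (galAdicCompletionMap (L := L) (IsCMField.complexConj L) hw)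
              (placeForm (Matrix.of fun i j : Fin 2 => if i.val + j.val + 1 = 2 then (1 : L) else 0) w.1))) :
              GL (Fin 2) (w.1.adicCompletion L)) : Matrix (Fin 2) (Fin 2) (w.1.adicCompletion L)).det)⁻¹ : ℝ≥0) : ℝ≥0∞)) ^ (-r) ∂ν' < ∞ := by
  classical
  have hc : IsCMField.complexConj L ≠ 1 := IsCMField.complexConj_ne_one L
  -- the pins of the one-place model: `σ_w` is a continuous involution
  have hσσ : ∀ x : w.1.adicCompletion L,
      galAdicCompletionMap (L := L) (IsCMField.complexConj L) hw (galAdicCompletionMap (L := L) (IsCMField.complexConj L) hw x) = x :=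
    fun x => galAdicCompletionMap_galAdicCompletionMap_of_smul_eq (IsCMField.complexConj L) w hc hw x
  have hσc : Continuous (galAdicCompletionMap (L := L) (IsCMField.complexConj L) hw) := continuous_galAdicCompletionMap L (IsCMField.complexConj L) hw
  -- the (MP) pins of the place `w`
  have hι := isClosedEmbedding_algebraMap_adicCompletion_place (IsCMField.complexConj L) hc v w hw
  have hιr : ∀ x : w.1.adicCompletion L, galAdicCompletionMap (L := L) (IsCMField.complexConj L) hw x = x ↔
      x ∈ Set.range (algebraMap (v.adicCompletion ↥(maximalRealSubfield L)) (w.1.adicCompletion L)) :=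
    fun x => galAdicCompletionMap_eq_self_iff_mem_range (IsCMField.complexConj L) hc v w hw x
  obtain ⟨lam, hlam⟩ := exists_units_galAdicCompletionMap_eq_neg (IsCMField.complexConj L) hc v w hw
  have hE := setOf_galAdicCompletionMap_mul_self_eq_one_infinite (IsCMField.complexConj L) hc v w hw
  -- characteristic zero, `2 ∈ L_wˣ`
  haveI : CharZero (w.1.adicCompletion L) := charZero_of_injective_algebraMap (algebraMap (L : Type) (w.1.adicCompletion L)).injective
  have h2 : (2 : w.1.adicCompletion L) ≠ 0 := two_ne_zero
  letI : Invertible (2 : w.1.adicCompletion L) := invertibleOfNonzero h2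
  -- the norm bridge ★ (NB)
  have hιn := fun x => normAbs_map_eq_sq_of_involution (algebraMap (v.adicCompletion ↥(maximalRealSubfield L)) (w.1.adicCompletion L)) hι.continuous
    (galAdicCompletionMap (L := L) (IsCMField.complexConj L) hw) hσσ hιr lam hlam x
  -- the form: `J_w = !![0,1;1,0]`, `det J_w` a unit
  have hJeq := UnitaryGroup.placeForm_antidiagTwo_eq L v w
  have hJd := isUnit_det_placeForm_antidiagTwo L v w
  -- topology of `K = L_w` and `M₂(K)`
  haveI : T2Space (w.1.adicCompletion L) := (IsNonarchimedeanLocalField.isLocalField (w.1.adicCompletion L)).toT2Space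
  haveI : LocallyCompactSpace (Matrix (Fin 2) (Fin 2) (w.1.adicCompletion L)) :=
    inferInstanceAs (LocallyCompactSpace (Fin 2 → Fin 2 → w.1.adicCompletion L))
  -- the Lie carrier with its Borel σ-algebra, local compactness and Haar measure
  obtain ⟨𝔲, h𝔲⟩ := exists_lieCarrier (galAdicCompletionMap (L := L) (IsCMField.complexConj L) hw)
    (placeForm (Matrix.of fun i j : Fin 2 => if i.val + j.val + 1 = 2 then (1 : L) else 0) w.1)
  letI : MeasurableSpace ↥𝔲 := borel _
  haveI : BorelSpace ↥𝔲 := ⟨rfl⟩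
  haveI : LocallyCompactSpace ↥𝔲 :=
    (isClosedEmbedding_subtype (galAdicCompletionMap (L := L) (IsCMField.complexConj L) hw)
      (placeForm (Matrix.of fun i j : Fin 2 => if i.val + j.val + 1 = 2 then (1 : L) else 0) w.1) 𝔲 hσc h𝔲).locallyCompactSpace
  -- the same carrier read with the literal form `!![0,1;1,0]` (for ★ (ε-Lie₂))
  have h𝔲' : ∀ X, X ∈ 𝔲 ↔ (X.map (galAdicCompletionMap (L := L) (IsCMField.complexConj L) hw))ᵀ * !![(0 : w.1.adicCompletion L), 1; 1, 0] +
      !![(0 : w.1.adicCompletion L), 1; 1, 0] * X = 0 := fun X => by rw [h𝔲 X, hJeq]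
  -- ★ (ε-Lie₂): the Lie-algebra statement on `𝔲(1,1)` at exponent `r`, `2r < 1`
  have hLie := forall_exists_nhds_setLIntegral_eta_rpow_lt_top_lie_two (galAdicCompletionMap (L := L) (IsCMField.complexConj L) hw) hσσ
    (algebraMap (v.adicCompletion ↥(maximalRealSubfield L)) (w.1.adicCompletion L)) hι hιr lam hlam hιn 𝔲 h𝔲' (addHaar : Measure ↥𝔲) hr1
  -- the group `U′`: local compactness and second countability from the organ carrier along ★ `localNonsplitEquiv`
  have e := (localNonsplitEquiv (IsCMField.complexConj L) (Matrix.of fun i j : Fin 2 => if i.val + j.val + 1 = 2 then (1 : L) else 0) hc w hw :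
    ((cmDatum L 2 (Matrix.of fun i j : Fin 2 => if i.val + j.val + 1 = 2 then (1 : L) else 0)).Local v) ≃ₜ*
      ↥(unitaryGroupOfForm (galAdicCompletionMap (L := L) (IsCMField.complexConj L) hw)
        (placeForm (Matrix.of fun i j : Fin 2 => if i.val + j.val + 1 = 2 then (1 : L) else 0) w.1)))
  haveI : LocallyCompactSpace ↥(unitaryGroupOfForm (galAdicCompletionMap (L := L) (IsCMField.complexConj L) hw)
      (placeForm (Matrix.of fun i j : Fin 2 => if i.val + j.val + 1 = 2 then (1 : L) else 0) w.1)) :=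
    e.symm.toHomeomorph.isClosedEmbedding.locallyCompactSpace
  haveI : SecondCountableTopology ↥(unitaryGroupOfForm (galAdicCompletionMap (L := L) (IsCMField.complexConj L) hw)
      (placeForm (Matrix.of fun i j : Fin 2 => if i.val + j.val + 1 = 2 then (1 : L) else 0) w.1)) :=
    e.symm.toHomeomorph.secondCountableTopology
  -- (ε-Cayley₂) at `G := ↥U′`, `ρ := U′.subtype`
  exact exists_nhds_setLIntegral_theta_rpow_lt_top (galAdicCompletionMap (L := L) (IsCMField.complexConj L) hw)
    (placeForm (Matrix.of fun i j : Fin 2 => if i.val + j.val + 1 = 2 then (1 : L) else 0) w.1) 𝔲 (addHaar : Measure ↥𝔲)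
    ((unitaryGroupOfForm (galAdicCompletionMap (L := L) (IsCMField.complexConj L) hw)
      (placeForm (Matrix.of fun i j : Fin 2 => if i.val + j.val + 1 = 2 then (1 : L) else 0) w.1)).subtype) ν'
    hσc h2 hJd h𝔲 IsInducing.subtypeVal Subtype.val_injective (mem_range_subtype_two_iff L v w hw) hE hr0 hLie g₀

/-! ## §3 The same in the `det⁻²` currency on `U(σ_w, J)(L_w)`, `J = (StdForm.antidiagonal 2).over L_w` — the (ε6)₂ letter `hHCD` of the (M5h)₂ weight kit -/

/-- **(ε-Model₂) IN THE `Fin 3 ↦ Fin 2` CURRENCY — `∫⁻_U (↑(‖disc χ_g‖·‖det g‖⁻²))^(−r) ∂ν′ < ∞` NEAR EVERY POINT of `U(σ_w, J)(L_w)`, `J = (StdForm.antidiagonal 2).over L_w`**,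
for `0 ≤ r`, `2r < 1`, every Borel structure and Haar measure `ν′`: ★ `placeForm_antidiagTwo_eq_over` identifies the carrier with §2's `U(σ_w, (Φ₂)_w)(L_w)`, and §1 `‖det g‖ = 1`
identifies the integrands pointwise (`(1²)⁻¹ = 1⁻¹`).  This is, for every admissible `r`, the letter `hHCD` of ★ `K2E3SupercuspidalTruncatedCharWeightKitTwo.locallyIntegrable_inv_token_*_place`
(`∀ g₀, ∃ U ∈ 𝓝 g₀, …` — apply this theorem to each `g₀`). [cite: HarishChandra1970, Part VII §1 Thm. 15] [cite: Rogawski1990, §4.9 p. 54; §12.5 p. 182] [cite: PlatonovRapinchuk1994, §3.3; §5.1] -/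
theorem hcd₂_model_rpow_of_eq_over {r : ℝ} (hr0 : 0 ≤ r) (hr1 : 2 * r < 1) {J : Matrix (Fin 2) (Fin 2) (w.1.adicCompletion L)}
    (hJ : J = (StdForm.antidiagonal 2).over (w.1.adicCompletion L))
    [MeasurableSpace ↥(unitaryGroupOfForm (galAdicCompletionMap (L := L) (IsCMField.complexConj L) hw) J)]
    [BorelSpace ↥(unitaryGroupOfForm (galAdicCompletionMap (L := L) (IsCMField.complexConj L) hw) J)]
    (ν' : Measure ↥(unitaryGroupOfForm (galAdicCompletionMap (L := L) (IsCMField.complexConj L) hw) J)) [ν'.IsHaarMeasure]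
    (g₀ : ↥(unitaryGroupOfForm (galAdicCompletionMap (L := L) (IsCMField.complexConj L) hw) J)) :
    ∃ U ∈ 𝓝 g₀, ∫⁻ g in U,
      (((normAbs (w.1.adicCompletion L) (((g : GL (Fin 2) (w.1.adicCompletion L)) : Matrix (Fin 2) (Fin 2) (w.1.adicCompletion L))).charpoly.discr *
        (normAbs (w.1.adicCompletion L) (((g : GL (Fin 2) (w.1.adicCompletion L)) : Matrix (Fin 2) (Fin 2) (w.1.adicCompletion L))).det ^ 2)⁻¹ : ℝ≥0) : ℝ≥0∞)) ^
        (-r) ∂ν' < ∞ := by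
  obtain rfl : J = placeForm (Matrix.of fun i j : Fin 2 => if i.val + j.val + 1 = 2 then (1 : L) else 0) w.1 :=
    hJ.trans (Literature.NumberTheory.Rogawski1990.placeForm_antidiagTwo_eq_over L w).symm
  obtain ⟨U, hU, hfin⟩ := hcd₂_model_rpow L v w hw hr0 hr1 ν' g₀
  refine ⟨U, hU, ?_⟩
  have hJd : (placeForm (Matrix.of fun i j : Fin 2 => if i.val + j.val + 1 = 2 then (1 : L) else 0) w.1).det ≠ 0 :=
    (isUnit_det_placeForm_antidiagTwo L v w).ne_zero
  have heq : (fun g : ↥(unitaryGroupOfForm (galAdicCompletionMap (L := L) (IsCMField.complexConj L) hw)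
      (placeForm (Matrix.of fun i j : Fin 2 => if i.val + j.val + 1 = 2 then (1 : L) else 0) w.1)) =>
      (((normAbs (w.1.adicCompletion L) (((g : GL (Fin 2) (w.1.adicCompletion L)) : Matrix (Fin 2) (Fin 2) (w.1.adicCompletion L))).charpoly.discr *
        (normAbs (w.1.adicCompletion L) (((g : GL (Fin 2) (w.1.adicCompletion L)) : Matrix (Fin 2) (Fin 2) (w.1.adicCompletion L))).det ^ 2)⁻¹ : ℝ≥0) : ℝ≥0∞)) ^
        (-r)) =
      fun g : ↥(unitaryGroupOfForm (galAdicCompletionMap (L := L) (IsCMField.complexConj L) hw)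
          (placeForm (Matrix.of fun i j : Fin 2 => if i.val + j.val + 1 = 2 then (1 : L) else 0) w.1)) =>
        (((normAbs (w.1.adicCompletion L) (((g : GL (Fin 2) (w.1.adicCompletion L)) : Matrix (Fin 2) (Fin 2) (w.1.adicCompletion L))).charpoly.discr *
        (normAbs (w.1.adicCompletion L) (((g : GL (Fin 2) (w.1.adicCompletion L)) : Matrix (Fin 2) (Fin 2) (w.1.adicCompletion L))).det)⁻¹ : ℝ≥0) : ℝ≥0∞)) ^
        (-r) := by
    funext g
    rw [normAbs_det_eq_one L v w hw hJd g, one_pow]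
  rw [heq]
  exact hfin

/-- **THE (ε6)₂ LETTER OF THE (M5h)₂ WEIGHT KIT, DISCHARGED**: at `r = (1 + 1∕4)∕4 = 5∕16` (`2r = 5∕8 < 1`), for `J = (StdForm.antidiagonal 2).over L_w`, every Borel structure, every
Haar measure `ν` on `U(σ_w, J)(L_w)` and every `g₀`: `∃ U ∈ 𝓝 g₀, ∫⁻_U (↑(‖disc χ_g‖·‖det g‖⁻²))^(−(1+1∕4)∕4) ∂ν < ∞` — token for token the binder `hHCD` of ★ p861141
`K2E3SupercuspidalTruncatedCharWeightKitTwo.locallyIntegrable_inv_token_rpow_five_quarters_place` ∕ `…_mul_log_pow_place` (pass `hHCD_five_sixteenths L v w hw hJ ν`).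
[cite: HarishChandra1970, Part VII §1 Thm. 15 p. 63] -/
theorem hHCD_five_sixteenths {J : Matrix (Fin 2) (Fin 2) (w.1.adicCompletion L)} (hJ : J = (StdForm.antidiagonal 2).over (w.1.adicCompletion L))
    [MeasurableSpace ↥(unitaryGroupOfForm (galAdicCompletionMap (L := L) (IsCMField.complexConj L) hw) J)]
    [BorelSpace ↥(unitaryGroupOfForm (galAdicCompletionMap (L := L) (IsCMField.complexConj L) hw) J)]
    (ν : Measure ↥(unitaryGroupOfForm (galAdicCompletionMap (L := L) (IsCMField.complexConj L) hw) J)) [ν.IsHaarMeasure] :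
    ∀ g₀ : ↥(unitaryGroupOfForm (galAdicCompletionMap (L := L) (IsCMField.complexConj L) hw) J), ∃ U ∈ 𝓝 g₀, ∫⁻ g in U,
      (((normAbs (w.1.adicCompletion L) (((g : GL (Fin 2) (w.1.adicCompletion L)) : Matrix (Fin 2) (Fin 2) (w.1.adicCompletion L))).charpoly.discr *
        (normAbs (w.1.adicCompletion L) (((g : GL (Fin 2) (w.1.adicCompletion L)) : Matrix (Fin 2) (Fin 2) (w.1.adicCompletion L))).det ^ 2)⁻¹ : ℝ≥0) : ℝ≥0∞)) ^
        (-((1 + 1 / 4) / 4 : ℝ)) ∂ν < ∞ :=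
  fun g₀ => hcd₂_model_rpow_of_eq_over L v w hw (by norm_num) (by norm_num) hJ ν g₀

end CM

end Summit.HodgeConjecture.HodgeConjecture.Cruxes.H413.K2E3U11WeylDiscrModelRpow

end
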